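import Mathlib
import Literature.AlgebraicGeometry.Tropical.InitialIdeal
import Literature.AlgebraicGeometry.Tropical.TropicalLink
import Summits.ResolutionOfSingularities.ResolutionOfSingularities.Theorems.TropicalLinksInductiveStepRayDegeneration
import Summits.ResolutionOfSingularities.ResolutionOfSingularities.Theorems.TropicalLinksInductiveStepDomCongr

/-!
# TropicalLinks / SchonResolves — the special fibre of the Gröbner family is the initial
# degeneration (Gröbner dictionary for an arbitrary integral weight)

Route `ResolutionOfSingularities/TropicalLinks`, crux `SchonResolves` (stmt-ResolutionOfSingularities-17234),
line `zariski-toric-closure`, stubs DIM-1a / DIM-1 (dimension of initial degenerations).  For an ideal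
`J ⊆ k[M]` of a Laurent polynomial ring (`M` any additive commutative group of exponents) and an
additive weight `φ : M →+ ℤ` (min-convention initial forms `in_φ` of `Tropical/InitialIdeal`), the
GRÖBNER DEGENERATION `t ↦ t^{-w} · V(J)` is realised without new definitions: extend `J` to
`k[ℤ × M] = k[t^±][M]` (`J^e = J.map k[inr]`), shear the exponent lattice by `ψ (a, u) = (a + φ u, u)`
(`k[ψ] = AddMonoidAlgebra.domCongr k k ψ`) and call the result `J̃ = k[ψ](J^e)`; the Gröbner family is
the partial compactification `k[ℕ × M] ⧸ (J̃ ∩ k[ℕ × M])` along `t`, with special fibre ideal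
`𝔣 = ((J̃ ∩ k[ℕ × M]) + (t)) ∩ k[M]` (written with the tree's `Tropical.linkIdeal`).

* `schonResolves_initialIdeal_map_mapDomainRingHom_inr` — for the sheared weight
  `χ (a, u) = a + φ u` on `ℤ × M`: `in_χ(J^e) = (in_φ J)^e`;
* `schonResolves_grobnerFamily_initialIdeal_fst_eq` (DIM-1a) — **the ray degeneration of the
  Gröbner family is the sheared extension of the initial ideal**: `in_{fst}(J̃) = k[ψ]((in_φ J)^e)`;
* `schonResolves_map_domCongr_map_of_isHomogeneous` — for a `φ`-homogeneous ideal `𝔞 ⊆ k[M]` the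
  shear fixes `𝔞^e`: `k[ψ](𝔞^e) = 𝔞^e`;
* `schonResolves_grobnerFamily_fibreIdeal_eq_initialIdeal` (DIM-1) — **the special fibre of the
  Gröbner family is the initial degeneration**: `𝔣 = in_φ(J)` (via the ray dictionary
  `tropicalLinks_linkIdeal_initialIdeal_fst_eq` of the sister crux InductiveStep).

Standard material (Maclagan–Sturmfels, *Introduction to Tropical Geometry*, §2.4–2.6; Helm–Katz 2012,
§3: initial degenerations as flat limits), here as self-contained commutative algebra over any
commutative ring `k`; no new definitions.
-/

-- single-problem summit: the doubled namespace component `ResolutionOfSingularities` is forced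
set_option linter.dupNamespace false

namespace Summit.ResolutionOfSingularities.ResolutionOfSingularities.Theorems

open AddMonoidAlgebra DirectSum Literature.AlgebraicGeometry.Tropical

section GrobnerFamily

variable {k : Type} [CommRing k] {M : Type} [AddCommGroup M]

/-! ### Initial forms and extension of scalars along a sublattice `k[L] ⊆ k[N]` -/

/-- **Initial forms commute with an injective change of exponents**: for `ι : L → N` injective
and a weight map `χ` on `N`, `in_χ(k[ι] g) = k[ι](in_{χ ∘ ι} g)`. [folklore] -/
theorem schonResolves_initialForm_mapDomain_of_injective {L N Λ : Type} [LinearOrder Λ]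
    {ι : L → N} (hι : Function.Injective ι) (χ : N → Λ) (g : AddMonoidAlgebra k L) :
    initialForm χ (mapDomain ι g) = mapDomain ι (initialForm (χ ∘ ι) g) := by
  classical
  apply coeff_injective
  ext v
  rw [coeff_initialForm_apply, coeff_mapDomain, coeff_mapDomain]
  by_cases hv : v ∈ Set.range ι
  · obtain ⟨a, rfl⟩ := hv
    rw [Finsupp.mapDomain_apply hι, Finsupp.mapDomain_apply hι, coeff_initialForm_apply]
    have hiff : (∀ u ∈ (Finsupp.mapDomain ι g.coeff).support, χ (ι a) ≤ χ u) ↔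
        ∀ b ∈ g.coeff.support, (χ ∘ ι) a ≤ (χ ∘ ι) b := by
      constructor
      · intro h b hb
        refine h (ι b) ?_
        rw [Finsupp.mapDomain_support_of_injective hι]
        exact Finset.mem_image_of_mem _ hb
      · intro h u hu
        rw [Finsupp.mapDomain_support_of_injective hι] at hu
        obtain ⟨b, hb, rfl⟩ := Finset.mem_image.1 hu
        exact h b hb
    by_cases hc : ∀ b ∈ g.coeff.support, (χ ∘ ι) a ≤ (χ ∘ ι) b
    · rw [if_pos (hiff.2 hc), if_pos hc]
    · rw [if_neg (mt hiff.1 hc), if_neg hc]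
  · rw [Finsupp.mapDomain_notin_range _ _ hv, Finsupp.mapDomain_notin_range _ _ hv, ite_self]

/-- `k[snd] ∘ k[inr] = id` on `k[M] ⊆ k[L' × M]`. [folklore] -/
theorem schonResolves_mapDomain_snd_mapDomain_inr {L' : Type} [AddCommGroup L']
    (g : AddMonoidAlgebra k M) :
    mapDomain (AddMonoidHom.snd L' M) (mapDomain (AddMonoidHom.inr L' M) g) = g := by
  apply coeff_injective
  rw [coeff_mapDomain, coeff_mapDomain, ← Finsupp.mapDomain_comp]
  have hid : (⇑(AddMonoidHom.snd L' M) ∘ ⇑(AddMonoidHom.inr L' M)) = id := funext fun _ => rfl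
  rw [hid, Finsupp.mapDomain_id]

/-- **The extension `J^e = J · k[L' × M]` of an ideal `J ⊆ k[M]` contracts back to `J`**:
`J^e ∩ k[M] = J` (the retraction `k[snd]` of `k[inr]` maps `J^e` onto `J`). [folklore] -/
theorem schonResolves_linkIdeal_inr_map_inr {L' : Type} [AddCommGroup L']
    (J : Ideal (AddMonoidAlgebra k M)) :
    linkIdeal (AddMonoidHom.inr L' M) (J.map (mapDomainRingHom k (AddMonoidHom.inr L' M))) = J := by
  refine le_antisymm (fun g hg => ?_) fun g hg => (mem_linkIdeal_iff _ _ _).2 ?_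
  · rw [mem_linkIdeal_iff] at hg
    have h1 := Ideal.mem_map_of_mem (mapDomainRingHom k (AddMonoidHom.snd L' M)) hg
    rw [Ideal.map_map, ← mapDomainRingHom_comp, AddMonoidHom.snd_comp_inr, mapDomainRingHom_id,
      Ideal.map_id, mapDomainRingHom_apply, schonResolves_mapDomain_snd_mapDomain_inr] at h1
    exact h1
  · exact Ideal.mem_map_of_mem (mapDomainRingHom k (AddMonoidHom.inr L' M)) hg

/-- A homogeneous component of weight at most the minimal weight of `G` is either the initial form
of `G` (if the weight is attained) or zero. [folklore] -/
theorem schonResolves_decompose_eq_initialForm_or_eq_zero {N : Type} [AddCommGroup N]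
    (χ : N →+ ℤ) (G : AddMonoidAlgebra k N) {m : ℤ} (hm : ∀ u ∈ G.coeff.support, m ≤ χ u) :
    ((decompose (gradeBy k χ) G m : gradeBy k χ m) : AddMonoidAlgebra k N) = initialForm χ G ∨
      ((decompose (gradeBy k χ) G m : gradeBy k χ m) : AddMonoidAlgebra k N) = 0 := by
  classical
  by_cases h : ∃ u ∈ G.coeff.support, χ u = m
  · obtain ⟨u, hu, rfl⟩ := h
    exact Or.inl (initialForm_eq_decompose χ hu hm).symm
  · push Not at h
    refine Or.inr ?_
    rw [decompose_gradeBy_coe, ofCoeff_eq_zero, Finsupp.filter_eq_zero_iff]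
    intro u hu
    by_contra hne
    exact h u (Finsupp.mem_support_iff.2 hne) hu

/-- **Initial ideals and extension along the sheared cylinder** (core of DIM-1a).  For `J ⊆ k[M]`,
its extension `J^e ⊆ k[ℤ × M] = k[t^±][M]` and the sheared weight `χ (a, u) = a + φ u`:
`in_χ(J^e) = (in_φ J)^e`.  (`⊇`: `in_χ(k[inr] f) = k[inr](in_φ f)`; `⊆`: an element of `J^e` is
`Σ_a t^a · k[inr](g_a)` with `g_a ∈ J`, and its `χ`-initial form is the sum, over the rows attaining
the minimal weight, of `t^a · k[inr](in_φ g_a)`.) [folklore] -/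
theorem schonResolves_initialIdeal_map_mapDomainRingHom_inr (φ : M →+ ℤ) (χ : ℤ × M →+ ℤ)
    (hχ : ∀ (a : ℤ) (u : M), χ (a, u) = a + φ u) (J : Ideal (AddMonoidAlgebra k M)) :
    initialIdeal χ (J.map (mapDomainRingHom k (AddMonoidHom.inr ℤ M))) =
      (initialIdeal φ J).map (mapDomainRingHom k (AddMonoidHom.inr ℤ M)) := by
  classical
  have hinj : Function.Injective (AddMonoidHom.inr ℤ M) := fun a b hab => (Prod.ext_iff.1 hab).2
  have hχinr : (⇑χ ∘ ⇑(AddMonoidHom.inr ℤ M)) = ⇑φ := funext fun u => by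
    rw [Function.comp_apply, AddMonoidHom.inr_apply, hχ, zero_add]
  have hin : ∀ g : AddMonoidAlgebra k M, initialForm χ (mapDomain (AddMonoidHom.inr ℤ M) g) =
      mapDomain (AddMonoidHom.inr ℤ M) (initialForm φ g) := by
    intro g
    rw [schonResolves_initialForm_mapDomain_of_injective hinj, hχinr]
  apply le_antisymm
  · -- `⊆`: the initial form of `F ∈ J^e` is a sum of initial forms of its `t`-homogeneous rows
    rw [initialIdeal, Ideal.span_le]
    rintro _ ⟨F, hF, rfl⟩
    rw [SetLike.mem_coe]
    by_cases hF0 : F = 0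
    · rw [hF0, initialForm_zero]
      exact Ideal.zero_mem _
    have hne : F.coeff.support.Nonempty := by
      rw [Finsupp.support_nonempty_iff, ne_eq, coeff_eq_zero]
      exact hF0
    obtain ⟨m₀, hm₀, hmin⟩ := F.coeff.support.exists_min_image χ hne
    rw [initialForm_eq_decompose χ hm₀ hmin,
      ← DirectSum.sum_support_decompose (gradeBy k (AddMonoidHom.fst ℤ M)) F, decompose_sum,
      DirectSum.sum_apply, Submodule.coe_sum]
    refine Ideal.sum_mem _ fun a _ => ?_
    set Fa : AddMonoidAlgebra k (ℤ × M) :=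
      ((decompose (gradeBy k (AddMonoidHom.fst ℤ M)) F a : gradeBy k (AddMonoidHom.fst ℤ M) a) :
        AddMonoidAlgebra k (ℤ × M)) with hFa_def
    have hFaJ : Fa ∈ J.map (mapDomainRingHom k (AddMonoidHom.inr ℤ M)) :=
      isHomogeneous_map_mapDomainRingHom_inr J a (SetLike.mem_coe.1 hF)
    have hFa_mem : Fa ∈ gradeBy k (AddMonoidHom.fst ℤ M) a :=
      (decompose (gradeBy k (AddMonoidHom.fst ℤ M)) F a).2
    have hsupp : ∀ u ∈ Fa.coeff.support, χ m₀ ≤ χ u := by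
      intro u hu
      apply hmin
      rw [hFa_def, decompose_gradeBy_coe, coeff_ofCoeff, Finsupp.support_filter] at hu
      exact (Finset.mem_filter.1 hu).1
    clear_value Fa
    rcases schonResolves_decompose_eq_initialForm_or_eq_zero χ Fa hsupp with h | h
    · rw [h, eq_single_mul_mapDomain_inr_of_mem_gradeBy hFa_mem,
        tropicalLinks_initialForm_single_one_mul, hin]
      refine Ideal.mul_mem_left _ _ (Ideal.mem_map_of_mem _ (initialForm_mem_initialIdeal φ ?_))
      rw [← schonResolves_linkIdeal_inr_map_inr (L' := ℤ) J, mem_linkIdeal_iff,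
        mapDomain_inr_mapDomain_snd_of_mem_gradeBy_zero (single_neg_mul_mem_gradeBy_zero hFa_mem)]
      exact Ideal.mul_mem_left _ _ hFaJ
    · rw [h]
      exact Ideal.zero_mem _
  · -- `⊇`: generators `k[inr](in_φ f) = in_χ(k[inr] f)`, `f ∈ J`
    rw [Ideal.map_le_iff_le_comap]
    refine Ideal.span_le.2 ?_
    rintro _ ⟨f, hf, rfl⟩
    rw [SetLike.mem_coe, Ideal.mem_comap, mapDomainRingHom_apply, ← hin]
    exact initialForm_mem_initialIdeal χ (Ideal.mem_map_of_mem _ hf)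

/-! ### The shear `ψ (a, u) = (a + φ u, u)` fixes extensions of `φ`-homogeneous ideals -/

/-- On a `φ`-homogeneous element `g` of degree `j`, the shear multiplies `k[inr] g` by the unit
`t^j`: `k[ψ](k[inr] g) = x^{(j,0)} · k[inr] g`. [folklore] -/
theorem schonResolves_domCongr_mapDomain_inr_of_mem_gradeBy (φ : M →+ ℤ) (ψ : ℤ × M ≃+ ℤ × M)
    (hψ : ∀ (a : ℤ) (u : M), ψ (a, u) = (a + φ u, u)) {g : AddMonoidAlgebra k M} {j : ℤ}
    (hg : g ∈ gradeBy k φ j) :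
    domCongr k k ψ (mapDomain (AddMonoidHom.inr ℤ M) g) =
      single ((j, 0) : ℤ × M) (1 : k) * mapDomain (AddMonoidHom.inr ℤ M) g := by
  classical
  have hinj : Function.Injective (AddMonoidHom.inr ℤ M) := fun a b hab => (Prod.ext_iff.1 hab).2
  have hsymm : ∀ (b : ℤ) (u : M), ψ.symm (b, u) = (b - φ u, u) := fun b u =>
    (AddEquiv.symm_apply_eq ψ).2 (by rw [hψ, sub_add_cancel])
  have hz : ∀ (c : ℤ) (u : M), c ≠ 0 →
      Finsupp.mapDomain (AddMonoidHom.inr ℤ M) g.coeff (c, u) = 0 := by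
    intro c u hc
    apply Finsupp.mapDomain_notin_range
    rintro ⟨v, hv⟩
    exact hc (congrArg Prod.fst hv).symm
  have h0 : ∀ u : M, Finsupp.mapDomain (AddMonoidHom.inr ℤ M) g.coeff (0, u) = g.coeff u := by
    intro u
    exact Finsupp.mapDomain_apply hinj g.coeff u
  apply coeff_injective
  ext ⟨b, u⟩
  rw [coeff_domCongr, hsymm, coeff_single_mul_apply, one_mul, Prod.neg_mk, neg_zero, Prod.mk_add_mk,
    zero_add, coeff_mapDomain]
  by_cases hgu : g.coeff u = 0
  · -- both sides vanish
    have hall : ∀ c : ℤ, Finsupp.mapDomain (AddMonoidHom.inr ℤ M) g.coeff (c, u) = 0 := by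
      intro c
      by_cases hc : c = 0
      · rw [hc, h0, hgu]
      · exact hz c u hc
    rw [hall, hall]
  · have hj : φ u = j := hg u (Finsupp.mem_support_iff.2 hgu)
    rw [hj, show -j + b = b - j by abel]

/-- **The shear fixes extensions of homogeneous ideals**: for `𝔞 ⊆ k[M]` homogeneous for the
`φ`-grading, `k[ψ](𝔞^e) = 𝔞^e` (`𝔞^e` is generated by the `k[inr] g`, `g ∈ 𝔞` homogeneous, on
which `k[ψ]` acts by units). [folklore] -/
theorem schonResolves_map_domCongr_map_of_isHomogeneous (φ : M →+ ℤ) (ψ : ℤ × M ≃+ ℤ × M)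
    (hψ : ∀ (a : ℤ) (u : M), ψ (a, u) = (a + φ u, u)) {𝔞 : Ideal (AddMonoidAlgebra k M)}
    (h𝔞 : 𝔞.IsHomogeneous (gradeBy k φ)) :
    (𝔞.map (mapDomainRingHom k (AddMonoidHom.inr ℤ M))).map (domCongr k k ψ) =
      𝔞.map (mapDomainRingHom k (AddMonoidHom.inr ℤ M)) := by
  classical
  have hunit : ∀ j : ℤ, single ((-j, 0) : ℤ × M) (1 : k) * single ((j, 0) : ℤ × M) (1 : k) = 1 := by
    intro j
    rw [single_mul_single, AddMonoidAlgebra.one_def, mul_one, Prod.mk_add_mk, neg_add_cancel, add_zero,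
      Prod.mk_zero_zero]
  apply le_antisymm
  · rw [Ideal.map_le_iff_le_comap, Ideal.map_le_iff_le_comap]
    intro g hg
    rw [Ideal.mem_comap, Ideal.mem_comap, ← DirectSum.sum_support_decompose (gradeBy k φ) g, map_sum,
      map_sum]
    refine Ideal.sum_mem _ fun j _ => ?_
    rw [mapDomainRingHom_apply, schonResolves_domCongr_mapDomain_inr_of_mem_gradeBy φ ψ hψ
      (decompose (gradeBy k φ) g j).2]
    exact Ideal.mul_mem_left _ _ (Ideal.mem_map_of_mem _ (h𝔞 j hg))
  · rw [Ideal.map_le_iff_le_comap]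
    intro g hg
    rw [Ideal.mem_comap, ← DirectSum.sum_support_decompose (gradeBy k φ) g, map_sum]
    refine Ideal.sum_mem _ fun j _ => ?_
    have hmem := (decompose (gradeBy k φ) g j).2
    have e : mapDomainRingHom k (AddMonoidHom.inr ℤ M) ((decompose (gradeBy k φ) g j : gradeBy k φ j) :
        AddMonoidAlgebra k M) = single ((-j, 0) : ℤ × M) (1 : k) *
          domCongr k k ψ (mapDomainRingHom k (AddMonoidHom.inr ℤ M)
            ((decompose (gradeBy k φ) g j : gradeBy k φ j) : AddMonoidAlgebra k M)) := by
      rw [mapDomainRingHom_apply, schonResolves_domCongr_mapDomain_inr_of_mem_gradeBy φ ψ hψ hmem,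
        ← mul_assoc, hunit, one_mul]
    rw [e]
    exact Ideal.mul_mem_left _ _ (Ideal.mem_map_of_mem _ (Ideal.mem_map_of_mem _ (h𝔞 j hg)))

/-- An initial ideal is homogeneous for the grading by its own weight (it is spanned by initial
forms, which are homogeneous). [folklore] -/
theorem schonResolves_initialIdeal_isHomogeneous (φ : M →+ ℤ) (J : Ideal (AddMonoidAlgebra k M)) :
    (initialIdeal φ J).IsHomogeneous (gradeBy k φ) := by
  unfold initialIdeal
  exact Ideal.homogeneous_span (gradeBy k φ) _
    (by rintro _ ⟨f, -, rfl⟩; exact isHomogeneousElem_initialForm φ f)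

end GrobnerFamily

/-! ### The registered stubs DIM-1a and DIM-1 -/

/-- **DIM-1a: the ray degeneration of the Gröbner family is the sheared extension of the initial
ideal.**  For `J ⊆ k[M]`, an additive weight `φ : M →+ ℤ` and the shear `ψ (a, u) = (a + φ u, u)`
of `ℤ × M`, with `J̃ = k[ψ](J^e) ⊆ k[ℤ × M]`: `in_{fst}(J̃) = k[ψ]((in_φ J)^e)` — initial forms
commute with `k[ψ]` up to the pulled-back weight `fst ∘ ψ = χ`, `χ (a, u) = a + φ u`, and
`in_χ(J^e) = (in_φ J)^e`. [folklore] -/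
theorem schonResolves_grobnerFamily_initialIdeal_fst_eq : ∀ (k : Type) [CommRing k] (M : Type) [AddCommGroup M] (φ : M →+ ℤ) (ψ : ℤ × M ≃+ ℤ × M), (∀ (a : ℤ) (u : M), ψ (a, u) = (a + φ u, u)) → ∀ (J : Ideal (AddMonoidAlgebra k M)), Literature.AlgebraicGeometry.Tropical.initialIdeal (AddMonoidHom.fst ℤ M) ((J.map (AddMonoidAlgebra.mapDomainRingHom k (AddMonoidHom.inr ℤ M))).map (AddMonoidAlgebra.domCongr k k ψ)) = ((Literature.AlgebraicGeometry.Tropical.initialIdeal φ J).map (AddMonoidAlgebra.mapDomainRingHom k (AddMonoidHom.inr ℤ M))).map (AddMonoidAlgebra.domCongr k k ψ) := by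
  intro k _ M _ φ ψ hψ J
  obtain ⟨χ, hχ⟩ : ∃ χ : ℤ × M →+ ℤ, ∀ (a : ℤ) (u : M), χ (a, u) = a + φ u :=
    ⟨(AddMonoidHom.fst ℤ M) + φ.comp (AddMonoidHom.snd ℤ M), fun a u => by simp⟩
  have hcomp : (⇑(AddMonoidHom.fst ℤ M) ∘ ⇑ψ) = ⇑χ := funext fun p => by
    obtain ⟨a, u⟩ := p
    rw [Function.comp_apply, hψ, hχ]
    rfl
  rw [tropicalLinks_initialIdeal_map_domCongr, hcomp,
    schonResolves_initialIdeal_map_mapDomainRingHom_inr φ χ hχ J]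

/-- **DIM-1: the special fibre of the Gröbner family is the initial degeneration.**  For
`J ⊆ k[M]`, `φ : M →+ ℤ`, the shear `ψ (a, u) = (a + φ u, u)` and `J̃ = k[ψ](J^e) ⊆ k[ℤ × M] =
k[t^±][M]`, the ideal of the fibre `{t = 0}` of the closure of `V(J̃)` in `𝔸¹_t × T_M` — the
restriction to `k[M]` of `(J̃ ∩ k[ℕ × M]) + (t)` — is the initial ideal `in_φ(J)`:
`lim_{t → 0} t^{-w} · V(J) = V(in_w J)` scheme-theoretically (Gröbner degeneration = flat limit;
Maclagan–Sturmfels §2.4–2.6, Helm–Katz 2012 §3), over any commutative ring `k`. [folklore] -/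
theorem schonResolves_grobnerFamily_fibreIdeal_eq_initialIdeal : ∀ (k : Type) [CommRing k] (M : Type) [AddCommGroup M] (φ : M →+ ℤ) (ψ : ℤ × M ≃+ ℤ × M), (∀ (a : ℤ) (u : M), ψ (a, u) = (a + φ u, u)) → ∀ (J : Ideal (AddMonoidAlgebra k M)), Literature.AlgebraicGeometry.Tropical.linkIdeal (AddMonoidHom.inr ℕ M) (Literature.AlgebraicGeometry.Tropical.linkIdeal ((Nat.castAddMonoidHom ℤ).prodMap (AddMonoidHom.id M)) ((J.map (AddMonoidAlgebra.mapDomainRingHom k (AddMonoidHom.inr ℤ M))).map (AddMonoidAlgebra.domCongr k k ψ)) ⊔ Ideal.span {AddMonoidAlgebra.single ((1 : ℕ), (0 : M)) (1 : k)}) = Literature.AlgebraicGeometry.Tropical.initialIdeal φ J := by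
  intro k _ M _ φ ψ hψ J
  classical
  rw [← tropicalLinks_linkIdeal_initialIdeal_fst_eq k M _,
    schonResolves_grobnerFamily_initialIdeal_fst_eq k M φ ψ hψ J,
    schonResolves_map_domCongr_map_of_isHomogeneous φ ψ hψ
      (schonResolves_initialIdeal_isHomogeneous φ J),
    schonResolves_linkIdeal_inr_map_inr]

end Summit.ResolutionOfSingularities.ResolutionOfSingularities.Theorems
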